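import Summits.BirchSwinnertonDyer.BirchSwinnertonDyer.Theorems.SignedBaseChangeAnticyclotomicEisensteinDivisibilityNakayamaDualTwoVar
import Summits.BirchSwinnertonDyer.BirchSwinnertonDyer.Theorems.SignedBaseChangeAnticyclotomicEisensteinDivisibilityFinitePiece
import Literature.NumberTheory.EllipticCurves.TwoVariableSelmerDual
import HarnessLib

/-!
# `X^ord(E/K̃_∞) = Sel_{p^∞}(E/K̃_∞)^∨ = XOrd₂` is a finitely generated `Λ₂`-module — unconditionally
# (crux `AnticyclotomicEisensteinDivisibility`, stmt-BirchSwinnertonDyer-20727, line `bdpline`; WAVE 2(b) of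
# the lead: the classical twin of `Module.Finite Λ₂ X_Gr₂`)

Helper file (THEOREMS ONLY — no definition, no named fact) of the `bsd-line-sbc-p1` line. The tree
CONSTRUCTS `XOrd₂ W p κ₁ κ₂ γ₁ γ₂ := Hom(Sel_{p^∞}(E/K̃_∞), ℚ/ℤ)` with its `Λ₂ = ℤ_p⟦T₂⟧⟦T₁⟧`-module
structure (`TwoVariableSelmerDual.lean` §5; Burungale–Castella–Skinner's `X^ord(E/K_∞)`, arXiv:2405.00270v2
p. 4, the object of their Conj. 4.1.1 / Thm. 1.4.1 / Thm. 4.1.3 (i); "finite generation … NOT claimed"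
there). This file proves that it IS finitely generated, for every number field `K`, every elliptic curve
`W/K`, every prime `p` and every pair of `ℤ_p`-extensions `(κ₁, κ₂)` of `K` with an adapted generator pair
`(γ₁, γ₂)` — Greenberg's argument (LNM 1716, §1 p. 60: "`X/𝔪X` is finite … By a version of Nakayama's
Lemma … for any prime `p`, with no restriction on the reduction type of `E`") over the `ℤ_p²`-tower:

* §1 `finite_setOf_selmerGroupOver_pair_pTorsion_conjH1_eq` — **`Sel_{p^∞}(E/K̃_∞)[𝔪]` is finite**,
  `𝔪 = (p, γ₁ − 1, γ₂ − 1)`: Kummer lift at level `pairKer κ₁ κ₂` (tree (A): `exists_torsionToPrimaryH1Sub_eq`,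
  `finite_ker_torsionToPrimaryH1Sub`), Selmer classes unramified outside `{bad} ∪ {v ∣ p}` (tree (B):
  `resOfLe_eq_zero_of_mem_selmerGroupOver`, Silverman X.4.4), and the two-variable descent
  `SignedBaseChangeAcDivFinitePiece.finite_setOf_conjH1_pair_eq_of_unramified` (lead bsd-line-sbc-p1,
  p607383/p607853/p608811: relative Greenberg Lemma 3.2 over `Gal(K̄/K̃_∞) ⊴ Gal(K̄/K_∞^{(1)})`, finite
  kernel of restriction, the tree's one-variable descent); assembly verbatim as the lead's
  `stub_finitePieceSS` with the classical Selmer condition in place of the Greenberg one.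
* §2 `moduleFinite_XOrd₂` — **`Module.Finite (IwasawaAlgebra₂ p) (W.XOrd₂ p κ₁ κ₂ γ₁ γ₂)`**: Nakayama's
  lemma for Pontryagin duals over `Λ₂` (`SignedBaseChangeAcDivNakayamaTwoVar.module_finite_of_dualPair₂`,
  p608929; Lang, *Cyclotomic Fields*, Ch. 5 §1) applied to the dual pair `(XOrd₂, Sel_{p^∞}(E/K̃_∞); id;
  conj_{γ₁} − 1, conj_{γ₂} − 1)` (`XOrd₂.X_smul_apply` / `CX_smul_apply` / `CC_smul_apply`,
  `isLocNil₂_conjSelOrd₂`) and §1.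

Serves the ordinary two-variable statements of the route (`X^ord` in BSTW24 / BCS25 Conj. 4.1.1
typings); not a registered stub (helper credit only). Nothing here bears on torsion, on the other stubs, or
on BSD.

## References
* R. Greenberg, *Iwasawa theory for elliptic curves*, LNM 1716 (1999), §1 p. 60 (after Conj. 1.3), §3
  Lemma 3.2.
* J. H. Silverman, *The Arithmetic of Elliptic Curves*, 2nd ed., X.4.3–4.4, VIII.1.4.
* S. Lang, *Cyclotomic Fields I and II*, GTM 121 (1990), Ch. 5 §1 (Nakayama's lemma).
* A. Burungale, F. Castella, C. Skinner, IMRN 2025 (arXiv:2405.00270v2), §1.4 p. 4, Conj. 4.1.1.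
* K. Rubin, Invent. Math. 103 (1991), §4 p. 36 (`Λ = ℤ_p[[𝒢]]`, two variables).
-/

-- D-0017: single-problem summit, the namespace repeats the problem name by design.
set_option linter.dupNamespace false
set_option autoImplicit false

open Literature.NumberTheory.EllipticCurves Literature.NumberTheory.GaloisRepresentations
open NumberField IsDedekindDomain

universe u

noncomputable section

namespace Summit.BirchSwinnertonDyer.BirchSwinnertonDyer.Theorems.SignedBaseChangeAcDivNakayamaTwoVar

/-! ## §1. `Sel_{p^∞}(E/K̃_∞)[𝔪]` is finite -/

/-- **`Sel_{p^∞}(E/K̃_∞)[𝔪]` is finite over the `ℤ_p²`-tower**: for an elliptic curve `W` over a number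
field `K`, ANY prime `p`, any pair of `ℤ_p`-extensions `(κ₁, κ₂)` with an adapted generator pair
`(γ₁, γ₂)`, the set of `s ∈ Sel_{p^∞}(E/K̃_∞) = W.selmerGroupOver p (pairKer κ₁ κ₂)` with `p s = 0`,
`conj_{γ₁} s = s`, `conj_{γ₂} s = s` is finite — the Pontryagin dual of "`X/𝔪X` is finite" for
`X = X^ord(E/K̃_∞)` (Greenberg, LNM 1716, §1 p. 60, two variables). Assembly as the lead's
`SignedBaseChangeAcDivFinitePiece.stub_finitePieceSS`: Kummer lift (A) with finite kernel, the classical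
(B) `resOfLe_eq_zero_of_mem_selmerGroupOver` (Silverman X.4.4) and the two-variable descent
`finite_setOf_conjH1_pair_eq_of_unramified` for `S = {bad} ∪ {v ∣ p}`.
[cite: GreenbergLNM1716, §1 p. 60 (after Conj. 1.3)] [cite: SilvermanAEC2009, Cor. X.4.4] -/
theorem finite_setOf_selmerGroupOver_pair_pTorsion_conjH1_eq {K : Type} [Field K] [NumberField K]
    (W : WeierstrassCurve K) [W.IsElliptic] (p : ℕ) [Fact p.Prime] (κ₁ κ₂ : ZpExtension K p)
    {γ₁ γ₂ : Field.absoluteGaloisGroup K} (hγ : ZpExtension.IsTopGeneratorPair κ₁ κ₂ γ₁ γ₂) :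
    Set.Finite {s : W.selmerGroupOver p (ZpExtension.pairKer κ₁ κ₂) |
      p • s = 0 ∧
        W.conjH1 p (ZpExtension.pairKer κ₁ κ₂) γ₁ (s : W.subgroupH1 p (ZpExtension.pairKer κ₁ κ₂)) = s ∧
        W.conjH1 p (ZpExtension.pairKer κ₁ κ₂) γ₂ (s : W.subgroupH1 p (ZpExtension.pairKer κ₁ κ₂)) = s} := by
  classical
  have hp := (Fact.out : p.Prime)
  -- notation
  let H := ZpExtension.pairKer κ₁ κ₂
  let ιN := W.torsionToPrimaryH1Sub p H
  -- the finite set of places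
  let S : Set (HeightOneSpectrum (𝓞 K)) := W.badPlaces (𝓞 K) ∪ {v | ((p : ℤ) : 𝓞 K) ∈ v.asIdeal}
  have hbad : (W.badPlaces (𝓞 K)).Finite := W.finite_badPlaces_holds (𝓞 K)
  have hS : S.Finite := hbad.union (WeierstrassCurve.finite_setOf_intCast_mem_asIdeal (by exact_mod_cast hp.ne_zero))
  have hSp : ∀ v : HeightOneSpectrum (𝓞 K), (p : 𝓞 K) ∈ v.asIdeal → v ∈ S := fun v hv ↦
    Or.inr (by simpa using hv)
  -- unramified predicate on `H¹(H, E[p])`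
  let Unr : subgroupH1 H (WeierstrassCurve.geomTorsion W (p : ℤ)) → Prop := fun x ↦
    ∀ v : HeightOneSpectrum (𝓞 K), v ∉ S → ∀ 𝔓 ∈ v.primesAbove,
      ∀ hle : 𝔓.inertia (Field.absoluteGaloisGroup K) ≤ H,
        resOfLe (WeierstrassCurve.geomTorsion W (p : ℤ)) hle x = 0
  have hUnr_sub : ∀ x y, Unr x → Unr y → Unr (x - y) := fun x y hx hy v hv 𝔓 h𝔓 hle ↦ by
    rw [map_sub, hx v hv 𝔓 h𝔓 hle, hy v hv 𝔓 h𝔓 hle, sub_zero]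
  -- (D₂) the doubly invariant unramified classes are finite
  haveI : Finite (WeierstrassCurve.geomTorsion W (p : ℤ)) :=
    WeierstrassCurve.finite_torsionPoints_holds W (AlgebraicClosure K) (by exact_mod_cast hp.ne_zero)
  haveI : ContinuousSMul (Field.absoluteGaloisGroup K) (WeierstrassCurve.geomTorsion W (p : ℤ)) :=
    WeierstrassCurve.continuousSMul_geomTorsion W (WeierstrassCurve.isOpen_stabilizer_point_holds W) _
  have hpM : ∀ m : WeierstrassCurve.geomTorsion W (p : ℤ), p • m = 0 := fun m ↦
    Subtype.ext (by rw [AddSubgroupClass.coe_nsmul, ZeroMemClass.coe_zero]; exact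
      AddSubgroup.torsionBy.nsmul_iff.mp m.2)
  have hA₀ := SignedBaseChangeAcDivFinitePiece.finite_setOf_conjH1_pair_eq_of_unramified
    (M := WeierstrassCurve.geomTorsion W (p : ℤ)) hγ hpM hS hSp
  -- (A) the kernel of `ιN` is finite
  have hF₀ := W.finite_ker_torsionToPrimaryH1Sub p (H := H) W.zsmul_geomPoints_surjective_holds
  -- the lifts `L = {y | ιN y ∈ Sel, conj_{γ_i} (ιN y) = ιN y}` form a finite set
  have hL : Set.Finite {y : subgroupH1 H (WeierstrassCurve.geomTorsion W (p : ℤ)) |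
      ιN y ∈ W.selmerGroupOver p H ∧ W.conjH1 p H γ₁ (ιN y) = ιN y ∧ W.conjH1 p H γ₂ (ιN y) = ιN y} := by
    -- `L ⊆ ⋃_{f₁, f₂ ∈ ker ιN} {y | Unr y ∧ conj₁ y - y = f₁ ∧ conj₂ y - y = f₂}`
    have hsub : {y : subgroupH1 H (WeierstrassCurve.geomTorsion W (p : ℤ)) |
        ιN y ∈ W.selmerGroupOver p H ∧ W.conjH1 p H γ₁ (ιN y) = ιN y ∧ W.conjH1 p H γ₂ (ιN y) = ιN y} ⊆
        ⋃ f₁ ∈ (ιN.ker : Set _), ⋃ f₂ ∈ (ιN.ker : Set _), {y | Unr y ∧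
          conjH1 H (WeierstrassCurve.geomTorsion W (p : ℤ)) γ₁ y - y = f₁ ∧
          conjH1 H (WeierstrassCurve.geomTorsion W (p : ℤ)) γ₂ y - y = f₂} := by
      rintro y ⟨hy0, hy1, hy2⟩
      simp only [Set.mem_iUnion, Set.mem_setOf_eq, SetLike.mem_coe, exists_prop]
      refine ⟨_, ?_, _, ?_, ?_, rfl, rfl⟩
      · rw [AddMonoidHom.mem_ker, map_sub, ← WeierstrassCurve.conjH1_torsionToPrimaryH1Sub, hy1, sub_self]
      · rw [AddMonoidHom.mem_ker, map_sub, ← WeierstrassCurve.conjH1_torsionToPrimaryH1Sub, hy2, sub_self]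
      · intro v hv 𝔓 h𝔓 hle
        have hv' : v ∉ W.badPlaces (𝓞 K) := fun h ↦ hv (Or.inl h)
        have hpv : ((p : ℕ) : 𝓞 K) ∉ v.asIdeal := fun h ↦ hv (hSp v h)
        exact W.resOfLe_eq_zero_of_mem_selmerGroupOver (H := H) hy0 hv' hpv h𝔓 hle
    refine (hF₀.biUnion fun f₁ _ ↦ hF₀.biUnion fun f₂ _ ↦ ?_).subset hsub
    -- each piece is empty or a translate of the finite set of (D₂)
    by_cases hne : {y | Unr y ∧ conjH1 H (WeierstrassCurve.geomTorsion W (p : ℤ)) γ₁ y - y = f₁ ∧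
        conjH1 H (WeierstrassCurve.geomTorsion W (p : ℤ)) γ₂ y - y = f₂}.Nonempty
    · obtain ⟨y₀, hy₀U, hy₀1, hy₀2⟩ := hne
      refine (hA₀.image fun a ↦ y₀ + a).subset ?_
      rintro y ⟨hyU, hy1, hy2⟩
      refine ⟨y - y₀, ⟨?_, ?_, hUnr_sub y y₀ hyU hy₀U⟩, by abel⟩
      · rw [map_sub, sub_eq_iff_eq_add.mp hy1, sub_eq_iff_eq_add.mp hy₀1]
        abel
      · rw [map_sub, sub_eq_iff_eq_add.mp hy2, sub_eq_iff_eq_add.mp hy₀2]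
        abel
    · rw [Set.not_nonempty_iff_eq_empty.mp hne]
      exact Set.finite_empty
  -- conclusion: the target set is the preimage under the (injective) coercion of a subset of `ιN '' L`
  refine ((hL.image ιN).preimage (Subtype.val_injective.injOn)).subset ?_
  rintro s ⟨hs0, hs1, hs2⟩
  have hps : p • (s : W.subgroupH1 p H) = 0 := by
    rw [← AddSubgroupClass.coe_nsmul, hs0, ZeroMemClass.coe_zero]
  obtain ⟨y, hy⟩ := W.exists_torsionToPrimaryH1Sub_eq p (H := H) W.zsmul_geomPoints_surjective_holds hps
  refine ⟨y, ⟨?_, ?_, ?_⟩, hy⟩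
  · show ιN y ∈ W.selmerGroupOver p H
    rw [show ιN y = (s : W.subgroupH1 p H) from hy]; exact s.2
  · show W.conjH1 p H γ₁ (ιN y) = ιN y
    rw [show ιN y = (s : W.subgroupH1 p H) from hy]; exact hs1
  · show W.conjH1 p H γ₂ (ιN y) = ιN y
    rw [show ιN y = (s : W.subgroupH1 p H) from hy]; exact hs2

/-! ## §2. `X^ord(E/K̃_∞)` is finitely generated over `Λ₂` -/

/-- **`X^ord(E/K̃_∞) = Sel_{p^∞}(E/K̃_∞)^∨` is a finitely generated `Λ₂`-module**: for every number field
`K`, elliptic curve `W/K`, prime `p` and pair of `ℤ_p`-extensions `(κ₁, κ₂)` with an adapted generator pair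
`(γ₁, γ₂)`, `Module.Finite (IwasawaAlgebra₂ p) (W.XOrd₂ p κ₁ κ₂ γ₁ γ₂)` — Nakayama's lemma for Pontryagin
duals over `Λ₂` (`module_finite_of_dualPair₂`, Lang Ch. 5 §1) for the dual pair
`(XOrd₂, Sel_{p^∞}(E/K̃_∞); id; conj_{γ₁} − 1, conj_{γ₂} − 1)` (`XOrd₂.X_smul_apply`, `CX_smul_apply`,
`CC_smul_apply`, `isLocNil₂_conjSelOrd₂`) and the finiteness of `Sel_{p^∞}(E/K̃_∞)[𝔪]` (§1). Burungale–
Castella–Skinner's `X^ord(E/K_∞)` over `Λ_K` (arXiv:2405.00270v2 p. 4), now with finite generation proved.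
[cite: GreenbergLNM1716, §1 p. 60 (after Conj. 1.3)] [cite: Lang1990, Ch. 5 §1 (Nakayama's lemma)]
[cite: BurungaleCastellaSkinner2025, §1.4 (p. 4 of arXiv:2405.00270v2), `X^ord(E/K_∞)`] -/
theorem moduleFinite_XOrd₂ {K : Type} [Field K] [NumberField K] (W : WeierstrassCurve K) [W.IsElliptic]
    (p : ℕ) [Fact p.Prime] (κ₁ κ₂ : ZpExtension K p) (γ₁ γ₂ : Field.absoluteGaloisGroup K)
    [hγ : Fact (ZpExtension.IsTopGeneratorPair κ₁ κ₂ γ₁ γ₂)] :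
    Module.Finite (IwasawaAlgebra₂ p) (W.XOrd₂ p κ₁ κ₂ γ₁ γ₂) := by
  have hpair : ZpExtension.IsTopGeneratorPair κ₁ κ₂ γ₁ γ₂ := hγ.out
  have hfin := finite_setOf_selmerGroupOver_pair_pTorsion_conjH1_eq W p κ₁ κ₂ hpair
  refine module_finite_of_dualPair₂ (S := W.selmerGroupOver p (ZpExtension.pairKer κ₁ κ₂))
    (X := W.XOrd₂ p κ₁ κ₂ γ₁ γ₂) (ψ₁ := W.conjSelOrd₂ p κ₁ κ₂ γ₁ - 1) (ψ₂ := W.conjSelOrd₂ p κ₁ κ₂ γ₂ - 1)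
    (AddMonoidHom.id _) Function.bijective_id (fun x s ↦ ?_) (fun x s ↦ ?_) (fun c x s k hk ↦ ?_)
    (W.isLocNil₂_conjSelOrd₂ p κ₁ κ₂ hpair) ?_
  · show ((PowerSeries.X : IwasawaAlgebra₂ p) • x) s = x ((W.conjSelOrd₂ p κ₁ κ₂ γ₁ - 1) s)
    rw [WeierstrassCurve.XOrd₂.X_smul_apply, IwasawaDual.End_sub_apply, AddMonoid.End.one_apply]
    exact (AddMonoidHom.map_sub (show W.selmerGroupOver p (ZpExtension.pairKer κ₁ κ₂) →+
      AddCircle (1 : ℚ) from x) _ _).symm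
  · show ((PowerSeries.C (PowerSeries.X : IwasawaAlgebra p) : IwasawaAlgebra₂ p) • x) s =
      x ((W.conjSelOrd₂ p κ₁ κ₂ γ₂ - 1) s)
    rw [WeierstrassCurve.XOrd₂.CX_smul_apply, IwasawaDual.End_sub_apply, AddMonoid.End.one_apply]
    exact (AddMonoidHom.map_sub (show W.selmerGroupOver p (ZpExtension.pairKer κ₁ κ₂) →+
      AddCircle (1 : ℚ) from x) _ _).symm
  · show ((PowerSeries.C (PowerSeries.C c : IwasawaAlgebra p) : IwasawaAlgebra₂ p) • x) s =
      (PadicInt.toZModPow k c).val • x s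
    exact WeierstrassCurve.XOrd₂.CC_smul_apply W p κ₁ κ₂ γ₁ γ₂ c x hk
  · refine hfin.subset fun s hs ↦ ?_
    obtain ⟨h0, h1, h2⟩ := hs
    rw [IwasawaDual.End_sub_apply, AddMonoid.End.one_apply, sub_eq_zero] at h1 h2
    exact ⟨h0, congrArg (fun z : W.selmerGroupOver p (ZpExtension.pairKer κ₁ κ₂) ↦
      (z : W.subgroupH1 p (ZpExtension.pairKer κ₁ κ₂))) h1,
      congrArg (fun z : W.selmerGroupOver p (ZpExtension.pairKer κ₁ κ₂) ↦
        (z : W.subgroupH1 p (ZpExtension.pairKer κ₁ κ₂))) h2⟩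

/-- The same for a curve over `ℚ` base-changed to a number field `K` (the shape of the route: `E/ℚ`, `K`
imaginary quadratic, `(κ₁, κ₂)` the cyclotomic/anticyclotomic pair): **`X^ord(E/K̃_∞)` is a finitely
generated `Λ₂`-module.** [cite: GreenbergLNM1716, §1 p. 60 (after Conj. 1.3)] -/
theorem moduleFinite_XOrd₂_baseChange (W : WeierstrassCurve ℚ) [W.IsElliptic] {K : Type} [Field K]
    [NumberField K] (p : ℕ) [Fact p.Prime] (κ₁ κ₂ : ZpExtension K p) (γ₁ γ₂ : Field.absoluteGaloisGroup K)
    [Fact (ZpExtension.IsTopGeneratorPair κ₁ κ₂ γ₁ γ₂)] :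
    Module.Finite (IwasawaAlgebra₂ p) ((W.baseChange K).XOrd₂ p κ₁ κ₂ γ₁ γ₂) := by
  haveI : (W.baseChange K).IsElliptic := by rw [WeierstrassCurve.baseChange]; infer_instance
  exact moduleFinite_XOrd₂ (W.baseChange K) p κ₁ κ₂ γ₁ γ₂

end Summit.BirchSwinnertonDyer.BirchSwinnertonDyer.Theorems.SignedBaseChangeAcDivNakayamaTwoVar

end
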